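import Summits.ABC.IUTFork.Cor312StatementSmallBadMassReal
import Summits.ABC.IUTFork.Cor312PilotIdelesPrWitness
import Summits.ABC.IUTFork.LDHSplitBadPrimeNumberField
import Literature.IUT.LogVolume.Corollary22TwoAdicIntegrality
import HarnessLib

/-!
# [IUTchIII] Cor. 3.12 — the typed Statement at `Real.settingPrVolSharp` HOLDS at explicit honest pilot data over EVERY
# number field `F ≠ ℚ` (NON-VACUITY of the small-bad-mass class; threshold `2·n_v ≤ [F:ℚ]`)

PROOF-ONLY sequel (abc-iut cell, Cor. 3.12 cone, D-0067; seat abc-iut-w4-d006, gen 4) of `Cor312StatementSmallBadMassReal`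
(p437008, `statement_settingPrVolSharp_of_lone_badMass_le`). TAKES NO SIDE on [IUTchIII] Cor. 3.12; theorems only, 0 `def`s,
no new `Prop` fact, no instance.
* §1 `mass_le_of_weight_le_half` — `Pr(v) ≤ 1/2 ⟹ Σ_{i<r} (i+1)²·Pr(v)^{i+1} ≤ r` for EVERY `r` (abc-iut-w5-d018
  `sum_sq_half_pow_le`, the sharp-in-`β` form); **`statement_settingPrVolSharp_of_lone_weight_le_half`** — `2·n_v ≤ [F:ℚ]` at
  every (lone, odd, unramified) bad place suffices for the typed Statement at `Real.settingPrVolSharp` (realising ideles,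
  any context, every depth).
* §2 **`exists_lone_half_pilotData`** — over EVERY number field `F` with `2 ≤ [F:ℚ]` and for every prime `ℓ ≥ 5` there are
  Dupuy–Hilado pilot data `X = (F, j_E, S, ℓ)` meeting ALL hypotheses: `S = {v₀}` a place of local degree `1` over an odd
  completely split prime `p` (which exists: the tree's Chebotarev consequence `infinite_setOf_splitsCompletely`, [FrdI] Thm.
  6.4 (iv) lineage), hence `p ∤ disc(F)` (Dedekind, Mathlib `NumberField.not_dvd_discr_iff_isUnramifiedIn`), `j_E := p^{−2ℓ}`
  so `ord_{v₀}(q_{v₀}) = 2ℓ` and realising Θ- and q-ideles EXIST (abc-iut-c312-3 `exists_realising_thetaIdeles` /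
  `exists_realising_qIdeles`, [IUTchI] Ex. 3.2 (iv)).
* §3 **`exists_pilotData_statement_settingPrVolSharp`** — HENCE, over every `F ≠ ℚ` and for every prime `ℓ ≥ 5`: pilot data
  and realising pilot ideles (non-zero, units off `S`) EXIST such that for EVERY choice of the [IUTchIII] Thm-3.11 context
  binders the typed `Cor312.Setting.Statement` HOLDS at abc-iut-c312-7's print-normalised sharp real setting — with print's own
  sharp glue, honest (realising) ideles, no re-gluing, no link identification. The REAL-SETTING twin of abc-iut-w5-d018's L-DH
  `exists_deep_cor312Of_self_of_two_le_finrank`; contrast abc-iut-w4-d107 (typed Statement FALSE at deep data of bad mass one,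
  e.g. over `F = ℚ`).
HONEST SCOPE. These pilot data are NOT the genuine pilot data of an initial Θ-datum (there `ℓ ∤ ord_v(q_v)`, abc-iut-C-cert-3
p432420, and over the print-faithful `K` every bad place is ramified, abc-iut-w5-d054 p436520): an F-PRESENTATION record showing
the typed Θ-side inequality at the setting of record is SATISFIABLE with honest ideles and decided by bad mass — nothing
about genuine data, the number-level `Cor22.Cor312AtDatum`, or abc. OUR sharp containers / typed (Ind1)(Ind2) throughout.
[claim: Mochizuki2012, status: disputed] for every IUT sentence quoted; [cite: DupuyHilado2025, §3.3, §3.6, §4.7];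
[cite: MochizukiFrdI2008, Thm. 6.4 (iv) p.116]. typed ≠ proved; instantiated ≠ endorsed.
-/

noncomputable section

open Set Function NumberField IsDedekindDomain
open scoped Pointwise

namespace Summit.ABC

namespace IUTFork

namespace Thm311

namespace Real

open Cor312 Cor312Vol Literature.IUT.LogThetaLattice Literature.IUT.LogVolume Literature.NumberTheory.NumberFields
  Literature.NumberTheory.GaloisRepresentations

variable {F : Type} [Field F] [NumberField F] (X : PilotData F) {logv : PadicLogs F} (hlog : LogvAnalytic logv)

/-! ## 1. The threshold `1/2` -/

/-- **`Pr(v) ≤ 1/2 ⟹ Σ_{i<r} (i+1)²·Pr(v)^{i+1} ≤ r`** for every `r` (termwise monotone in `Pr(v)`, then abc-iut-w5-d018's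
`sum_sq_half_pow_le`). [folklore] -/
theorem mass_le_of_weight_le_half {v : HeightOneSpectrum (𝓞 F)} (hv : weight F v ≤ 1 / 2) (r : ℕ) :
    ∑ i : Fin r, (((i : ℕ) : ℝ) + 1) ^ 2 * weight F v ^ ((i : ℕ) + 1) ≤ (r : ℝ) :=
  calc ∑ i : Fin r, (((i : ℕ) : ℝ) + 1) ^ 2 * weight F v ^ ((i : ℕ) + 1)
      ≤ ∑ i : Fin r, (((i : ℕ) : ℝ) + 1) ^ 2 * (1 / 2 : ℝ) ^ ((i : ℕ) + 1) :=
        Finset.sum_le_sum fun i _ =>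
          mul_le_mul_of_nonneg_left (pow_le_pow_left₀ (weight_nonneg F v) hv _) (by positivity)
    _ ≤ (r : ℝ) := SplitBadPrime.sum_sq_half_pow_le r

section Sharp

variable (M : Type) [Field M] [NumberField M]
  (archPk : ∀ (j : (thetaIndex X).Label) (vQ : (thetaIndex X).VQ), Set ((logShellsDH X logv).Packet j vQ))
  (archSub : ∀ (j : (thetaIndex X).Label) (v : (thetaIndex X).V),
    Set ((logShellsDH X logv).Packet j ((thetaIndex X).over v)))
  (Ψ : ℤ → ∀ v : (thetaIndex X).V, v ∈ (thetaIndex X).Vbad → Set ((logShellsDH X logv).StarPacket v))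
  (act : ℤ → ∀ v : (thetaIndex X).V, v ∈ (thetaIndex X).Vbad →
    (logShellsDH X logv).StarPacket v → Module.End ℚ ((logShellsDH X logv).StarPacket v))
  (Mmod : ℤ → ∀ j : (thetaIndex X).LabelStar, Set ((logShellsDH X logv).GlobalPacket j.1))
  (region : ℤ → ∀ j : (thetaIndex X).LabelStar, FinDivisor M → ∀ vQ : (thetaIndex X).VQ,
    Set ((logShellsDH X logv).Packet j.1 vQ))
  (n : ℤ) {HT : Type} {LogLink : HT → HT → Type} {IsFull : ∀ {s t : HT}, LogLink s t → Prop}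
  (lat : LGPGaussianLogThetaLattice LogLink IsFull)
  {Frd : Type} {IsoF : Frd → Frd → Type} {Ob : Frd → Type} {realify : Frd → Frd} {Strip : Type}
  {IsoS : Strip → Strip → Type} {Mv : ∀ v : (thetaIndex X).V, v ∈ (thetaIndex X).Vbad → Type}
  [∀ v h, Monoid (Mv v h)]
  (sig : GlobalLGPFrobenioidSignature (thetaIndex X).lstar (thetaIndex X).V (· ∈ (thetaIndex X).Vbad)
    Frd IsoF Ob realify Strip IsoS Mv)
  (split : SplittingMonoids Mv) {ObΔ : Type} {N : ∀ v : (thetaIndex X).V, v ∈ (thetaIndex X).Vbad → Type}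
  [∀ v h, Monoid (N v h)] (qData : QPilotData ObΔ N)
  (t : ∀ (pp : Nat.Primes) (_ : Fin X.lstar) (x : (thetaIndex X).Fibre (.inr pp)),
    haveI : Fact (pp : ℕ).Prime := ⟨pp.2⟩; kOf X pp.1 x)
  (tq : ∀ (pp : Nat.Primes) (x : (thetaIndex X).Fibre (.inr pp)), haveI : Fact (pp : ℕ).Prime := ⟨pp.2⟩; kOf X pp.1 x)
  (ht0 : ∀ pp i x, t pp i x ≠ 0)
  (ht1 : ∀ (pp : Nat.Primes) (i : Fin X.lstar) (x : (thetaIndex X).Fibre (.inr pp)),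
    haveI : Fact (pp : ℕ).Prime := ⟨pp.2⟩; placeOf X pp.1 x ∉ X.S → ‖t pp i x‖ = 1)
  /- the Θ-ideles REALISE `P_Θ` in Dupuy–Hilado's normalisation (3.4) -/
  (ht : ∀ (pp : Nat.Primes) (i : Fin X.lstar) (x : (thetaIndex X).Fibre (.inr pp)),
    haveI : Fact (pp : ℕ).Prime := ⟨pp.2⟩
    Real.log ‖t pp i x‖ = -(X.thetaPilot i (placeOf X pp.1 x)) * logNorm F (placeOf X pp.1 x) /
      localDegree F (placeOf X pp.1 x))
  (htq0 : ∀ pp x, tq pp x ≠ 0)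
  (htq1 : ∀ (pp : Nat.Primes) (x : (thetaIndex X).Fibre (.inr pp)),
    haveI : Fact (pp : ℕ).Prime := ⟨pp.2⟩; placeOf X pp.1 x ∉ X.S → ‖tq pp x‖ = 1)


include ht0 ht1 ht in
/-- **`2·n_v ≤ [F:ℚ]` at every bad place suffices** (with the lone / odd / unramified conditions and realising ideles): the
typed Statement of [IUTchIII] Cor. 3.12 holds at `Real.settingPrVolSharp` for ANY Thm-3.11 context and EVERY idele depth.
[cite: DupuyHilado2025, §3.3, §3.6] [claim: Mochizuki2012, status: disputed] -/
theorem statement_settingPrVolSharp_of_lone_weight_le_half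
    (htq : ∀ (pp : Nat.Primes) (x : (thetaIndex X).Fibre (.inr pp)),
      haveI : Fact (pp : ℕ).Prime := ⟨pp.2⟩
      Real.log ‖tq pp x‖ = -(X.qPilot (placeOf X pp.1 x)) * logNorm F (placeOf X pp.1 x) /
        localDegree F (placeOf X pp.1 x))
    (hodd : ∀ v ∈ X.S, 2 < residueChar F v)
    (hunr : ∀ v ∈ X.S, ¬ ((residueChar F v : ℕ) : ℤ) ∣ NumberField.discr F)
    (hlone : ∀ v ∈ X.S, ∀ w ∈ X.S, residueChar F w = residueChar F v → w = v)
    (hhalf : ∀ v ∈ X.S, 2 * localDegree F v ≤ Module.finrank ℚ F) :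
    (settingPrVolSharp X hlog M archPk archSub Ψ act Mmod region n lat sig split qData tq t htq0 htq1).Statement := by
  refine statement_settingPrVolSharp_of_lone_badMass_le X hlog M archPk archSub Ψ act Mmod region n lat sig split qData t
    tq ht0 ht1 ht htq0 htq1 htq hodd hunr hlone fun v hv => mass_le_of_weight_le_half (F := F) ?_ X.lstar
  have hd : (0 : ℝ) < (Module.finrank ℚ F : ℝ) := by exact_mod_cast Module.finrank_pos
  unfold weight
  rw [div_le_iff₀ hd]
  have h' : (2 : ℝ) * (localDegree F v : ℝ) ≤ (Module.finrank ℚ F : ℝ) := by exact_mod_cast hhalf v hv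
  linarith

end Sharp

/-! ## 2. Pilot data meeting every hypothesis exist over every number field `F ≠ ℚ` -/

/-- **NON-VACUITY OF THE HYPOTHESIS CLASS.** Over every number field `F` with `2 ≤ [F:ℚ]` and for every prime `ℓ ≥ 5` there
are Dupuy–Hilado pilot data `X = (F, j_E, S, ℓ)` with: `S = {v₀}`, `v₀` of local degree `1` over an odd completely split prime
`p` (so `p ∤ disc(F)`, no other bad place over `p`, `2·n_{v₀} ≤ [F:ℚ]`), and `2ℓ ∣ ord_{v₀}(q_{v₀})` (`j_E := p^{−2ℓ}`) — the
divisibility under which realising pilot ideles exist ([IUTchI] Ex. 3.2 (iv), abc-iut-c312-3). Classical input: a completely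
split prime exists (the tree's Chebotarev consequence). [cite: MochizukiFrdI2008, Thm. 6.4 (iv) p.116] [cite: DupuyHilado2025, §3.3] -/
theorem exists_lone_half_pilotData (h2 : 2 ≤ Module.finrank ℚ F) (l : ℕ) (hl : l.Prime) (h5 : 5 ≤ l) :
    ∃ X : PilotData F, X.l = l ∧ ∀ v ∈ X.S,
      2 < residueChar F v ∧ ¬ ((residueChar F v : ℕ) : ℤ) ∣ NumberField.discr F ∧
        (∀ w ∈ X.S, residueChar F w = residueChar F v → w = v) ∧
        2 * localDegree F v ≤ Module.finrank ℚ F ∧ (2 * (l : ℤ)) ∣ X.ordq v := by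
  classical
  -- an odd completely split prime `p` and a place `v₀ | p`
  obtain ⟨p, ⟨hp, hsplit⟩, h2p⟩ := (infinite_setOf_splitsCompletely F).exists_gt 2
  haveI : Fact p.Prime := ⟨hp⟩
  obtain ⟨v₀, hv₀⟩ := placesOver_nonempty F p
  have hrc : residueChar F v₀ = p := (mem_placesOver_iff_residueChar v₀).mp hv₀
  have hram : ord F v₀ (p : F) = ramIdx F v₀ := Cor22.ord_natCast_eq_ramIdx p v₀ hv₀
  have he0 : 0 < ramIdx F v₀ := Nat.pos_of_ne_zero (ramIdx_ne_zero F v₀)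
  have hord : ord F v₀ (((p : F)⁻¹) ^ (2 * l)) = -(2 * (l : ℤ) * ramIdx F v₀) := by
    rw [ord_pow, ord_inv, hram]; push_cast; ring
  have hdisc : ¬ ((p : ℕ) : ℤ) ∣ NumberField.discr F :=
    (NumberField.not_dvd_discr_iff_isUnramifiedIn F (𝓞 F) (Nat.prime_iff_prime_int.mp hp)).mpr hsplit.1
  let S₀ : Finset (HeightOneSpectrum (𝓞 F)) := {v₀}
  refine ⟨⟨((p : F)⁻¹) ^ (2 * l), S₀, Finset.singleton_nonempty v₀, ?_, l, hl, h5⟩, rfl, ?_⟩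
  · intro v hv
    rw [Finset.mem_singleton] at hv
    subst hv
    rw [hord]
    have : (0 : ℤ) < 2 * (l : ℤ) * ramIdx F v := by positivity
    linarith
  · intro v hv
    have hv' : v = v₀ := Finset.mem_singleton.mp hv
    subst hv'
    refine ⟨by rw [hrc]; exact h2p, by rw [hrc]; exact hdisc, fun w hw _ => Finset.mem_singleton.mp hw, ?_, ?_⟩
    · rw [localDegree_eq_one_of_splitsCompletely hsplit hv₀, mul_one]
      exact h2
    · refine ⟨(ramIdx F v : ℤ), ?_⟩
      show -ord F v (((p : F)⁻¹) ^ (2 * l)) = _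
      rw [hord]; ring

/-! ## 3. The typed Statement HOLDS at honest data over every `F ≠ ℚ` -/

/-- **NON-VACUITY AT THE REAL SETTING OF RECORD: over EVERY number field `F ≠ ℚ` and for every prime `ℓ ≥ 5` there are pilot
data and REALISING pilot ideles (non-zero, units off `S`) at which, for EVERY choice of the [IUTchIII] Thm-3.11 context
binders, the typed `Cor312.Setting.Statement` HOLDS at `Real.settingPrVolSharp`** — print's own sharp glue, honest ideles, no
re-gluing, no link identification (§2 + abc-iut-c312-3's realising ideles + `statement_settingPrVolSharp_of_lone_weight_le_half`).
The real-setting twin of abc-iut-w5-d018's L-DH `exists_deep_cor312Of_self_of_two_le_finrank`; contrast abc-iut-w4-d107 (FALSE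
at deep data of bad mass one). F-PRESENTATION record (module docstring HONEST SCOPE): not genuine initial-Θ-data pilot data.
[cite: DupuyHilado2025, §3.3, §3.6, §4.7] [cite: MochizukiFrdI2008, Thm. 6.4 (iv) p.116] [claim: Mochizuki2012, status: disputed] -/
theorem exists_pilotData_statement_settingPrVolSharp (h2 : 2 ≤ Module.finrank ℚ F) (l : ℕ) (hl : l.Prime)
    (h5 : 5 ≤ l) :
    ∃ (X : PilotData F) (t : ∀ (pp : Nat.Primes) (_ : Fin X.lstar) (x : (thetaIndex X).Fibre (.inr pp)),
        haveI : Fact (pp : ℕ).Prime := ⟨pp.2⟩; kOf X pp.1 x)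
      (tq : ∀ (pp : Nat.Primes) (x : (thetaIndex X).Fibre (.inr pp)), haveI : Fact (pp : ℕ).Prime := ⟨pp.2⟩; kOf X pp.1 x)
      (htq0 : ∀ pp x, tq pp x ≠ 0)
      (htq1 : ∀ (pp : Nat.Primes) (x : (thetaIndex X).Fibre (.inr pp)),
        haveI : Fact (pp : ℕ).Prime := ⟨pp.2⟩; placeOf X pp.1 x ∉ X.S → ‖tq pp x‖ = 1),
      X.l = l ∧ (∀ pp i x, t pp i x ≠ 0) ∧
      ∀ {logv : PadicLogs F} (hlog : LogvAnalytic logv) (M : Type) [Field M] [NumberField M]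
        (archPk : ∀ (j : (thetaIndex X).Label) (vQ : (thetaIndex X).VQ), Set ((logShellsDH X logv).Packet j vQ))
        (archSub : ∀ (j : (thetaIndex X).Label) (v : (thetaIndex X).V),
          Set ((logShellsDH X logv).Packet j ((thetaIndex X).over v)))
        (Ψ : ℤ → ∀ v : (thetaIndex X).V, v ∈ (thetaIndex X).Vbad → Set ((logShellsDH X logv).StarPacket v))
        (act : ℤ → ∀ v : (thetaIndex X).V, v ∈ (thetaIndex X).Vbad →
          (logShellsDH X logv).StarPacket v → Module.End ℚ ((logShellsDH X logv).StarPacket v))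
        (Mmod : ℤ → ∀ j : (thetaIndex X).LabelStar, Set ((logShellsDH X logv).GlobalPacket j.1))
        (region : ℤ → ∀ j : (thetaIndex X).LabelStar, FinDivisor M → ∀ vQ : (thetaIndex X).VQ,
          Set ((logShellsDH X logv).Packet j.1 vQ))
        (n : ℤ) {HT : Type} {LogLink : HT → HT → Type} {IsFull : ∀ {s t : HT}, LogLink s t → Prop}
        (lat : LGPGaussianLogThetaLattice LogLink IsFull)
        {Frd : Type} {IsoF : Frd → Frd → Type} {Ob : Frd → Type} {realify : Frd → Frd} {Strip : Type}
        {IsoS : Strip → Strip → Type} {Mv : ∀ v : (thetaIndex X).V, v ∈ (thetaIndex X).Vbad → Type}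
        [∀ v h, Monoid (Mv v h)]
        (sig : GlobalLGPFrobenioidSignature (thetaIndex X).lstar (thetaIndex X).V (· ∈ (thetaIndex X).Vbad)
          Frd IsoF Ob realify Strip IsoS Mv)
        (split : SplittingMonoids Mv) {ObΔ : Type} {N : ∀ v : (thetaIndex X).V, v ∈ (thetaIndex X).Vbad → Type}
        [∀ v h, Monoid (N v h)] (qData : QPilotData ObΔ N),
        (settingPrVolSharp X hlog M archPk archSub Ψ act Mmod region n lat sig split qData tq t htq0 htq1).Statement := by
  obtain ⟨X, hXl, hX⟩ := exists_lone_half_pilotData (F := F) h2 l hl h5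
  have hdiv : ∀ v ∈ X.S, (2 * X.l : ℤ) ∣ X.ordq v := fun v hv => by rw [hXl]; exact (hX v hv).2.2.2.2
  obtain ⟨t, ht0, ht⟩ := exists_realising_thetaIdeles X hdiv
  obtain ⟨tq, htq0, htq⟩ := exists_realising_qIdeles X hdiv
  have ht1 : ∀ (pp : Nat.Primes) (i : Fin X.lstar) (x : (thetaIndex X).Fibre (.inr pp)),
      haveI : Fact (pp : ℕ).Prime := ⟨pp.2⟩; placeOf X pp.1 x ∉ X.S → ‖t pp i x‖ = 1 :=
    fun pp i x hx => norm_eq_one_of_realises X t ht0 ht pp i x hx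
  have htq1 : ∀ (pp : Nat.Primes) (x : (thetaIndex X).Fibre (.inr pp)),
      haveI : Fact (pp : ℕ).Prime := ⟨pp.2⟩; placeOf X pp.1 x ∉ X.S → ‖tq pp x‖ = 1 :=
    fun pp x hx => qIdele_norm_eq_one_of_realises X tq htq0 htq pp x hx
  refine ⟨X, t, tq, htq0, htq1, hXl, ht0, ?_⟩
  intro logv hlog M _ _ archPk archSub Ψ act Mmod region n HT LogLink IsFull lat Frd IsoF Ob realify Strip IsoS Mv _ sig
    split ObΔ N _ qData
  exact statement_settingPrVolSharp_of_lone_weight_le_half X hlog M archPk archSub Ψ act Mmod region n lat sig split qData t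
    tq ht0 ht1 ht htq0 htq1 htq (fun v hv => (hX v hv).1) (fun v hv => (hX v hv).2.1) (fun v hv => (hX v hv).2.2.1)
    (fun v hv => (hX v hv).2.2.2.1)

end Real

end Thm311

end IUTFork

end Summit.ABC

end
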